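import Summits.CriticalPhenomena.PercolationContinuityZ3.Theorems.SahiMasterFamilyBernsteinPos

/-!
# Bernstein positivity on the SIMPLEX (`BPosS`): nonnegative combinations of monomials `∏_x w_x^{e_x}`, `Σ_x e_x ≤ d`, as functions of a
# weight vector `w : α → ℝ` with `Σ_x w_x = 1` — the multi-family book-keeping for conjecture (B) (`…UCBernsteinPartialUnions`)

Unit `prim-masterthm-p4` (gen 22; crux anchor stmt-CriticalPhenomena-4575, helper work; memo
`run/shared/lean/prim/prim-masterthm/prim-masterthm-p4/P4-GEN22-REPORT.md` §2b).  Multi-index companion of `…BernsteinPos` (one weight `w`,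
monomials `w^p(1−w)^q`): here the weights `w : α → ℝ` of a finite mixture `Σ_x w_x 1_{𝒰_x}` range over the simplex `Σ_x w_x = 1` and
`BPosS d f` says that ON THE SIMPLEX `f(w) = Σ_i a_i ∏_x w_x^{e_i(x)}` with `a_i ≥ 0`, `Σ_x e_i(x) ≤ d` — after multiplying each monomial by
`(Σ_x w_x)^{d − |e_i|} = 1` exactly "the degree-`d` Bernstein coefficients of `f` on the simplex are nonnegative", the form in which conjecture (B)
(`UCBernstein.UCBernsteinNonneg`: layer sums `N_j ≥ 0`) is stated.  CONTENTS: the algebra of `BPosS` (constants, coordinates `w_x`, sums, products —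
degrees add —, nonnegative scalars, finite sums and products, degree raising, transport along equality on the simplex, nonnegativity on the
standard simplex); the multi-family mixture `mixS 𝒰 w = Σ_x w_x 1_{𝒰_x}`, its restrictions along embeddings (`mixS_map`, pull-backs `BernsteinPos.comap`),
relabelling invariance (`phiSet_mixS_comap_perm`), and the degree bounds used by the induction of `…UCBernsteinPartialUnions`: every defect factor
`1 − β_S = Σ_x w_x [S ∉ 𝒰_x]` is `BPosS 1` on the simplex (`bposS_one_sub_mixS`) and `W(β) = Σ_σ ∏_{c ∈ cyc σ}(1 − β_c)` is `BPosS k` (`bposS_W`).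
HONEST FRAMING: toolkit; conjecture (B), `UCHullNonneg k` (k ≥ 8), Sahi's `C_k` and the master theorem remain OPEN.  Axioms standard. [this work]
-/

noncomputable section

open scoped Classical

namespace Summit.CriticalPhenomena.PercolationContinuityZ3.Theorems

namespace BernsteinSimplex

open Finset Function Equiv
open Literature.Combinatorics.Sahi2008
open Literature.Combinatorics.Sahi2008.CycleForm
open PrincipalCapBeta (phiSet realF realW)
open BernsteinPos

variable {α : Type} [Fintype α]

/-! ### Bernstein positivity on the simplex -/

/-- `BPosS d f`: on the simplex `Σ_x w_x = 1` the function `f : (α → ℝ) → ℝ` agrees with a nonnegative combination of monomials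
`∏_x w_x^{e(x)}` of total degree `Σ_x e(x) ≤ d`. [this work] -/
def BPosS (d : ℕ) (f : (α → ℝ) → ℝ) : Prop :=
  ∃ (ι : Type) (_ : Fintype ι) (a : ι → ℝ) (e : ι → α → ℕ),
    (∀ i, 0 ≤ a i) ∧ (∀ i, ∑ x, e i x ≤ d) ∧ ∀ w : α → ℝ, ∑ x, w x = 1 → f w = ∑ i, a i * ∏ x, w x ^ e i x

/-- Degree monotonicity. [this work] -/
theorem BPosS.mono {d d' : ℕ} {f : (α → ℝ) → ℝ} (h : BPosS d f) (hd : d ≤ d') : BPosS d' f := by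
  obtain ⟨ι, hι, a, e, ha, he, hf⟩ := h
  exact ⟨ι, hι, a, e, ha, fun i => (he i).trans hd, hf⟩

/-- Transport along equality on the simplex. [this work] -/
theorem BPosS.congr {d : ℕ} {f g : (α → ℝ) → ℝ} (h : BPosS d f) (hfg : ∀ w : α → ℝ, ∑ x, w x = 1 → f w = g w) : BPosS d g := by
  obtain ⟨ι, hι, a, e, ha, he, hf⟩ := h
  exact ⟨ι, hι, a, e, ha, he, fun w hw => (hfg w hw).symm.trans (hf w hw)⟩

/-- A single monomial with a nonnegative coefficient. [this work] -/
theorem bposS_monomial {d : ℕ} {c : ℝ} (hc : 0 ≤ c) (e : α → ℕ) (h : ∑ x, e x ≤ d) :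
    BPosS d (fun w => c * ∏ x, w x ^ e x) :=
  ⟨Unit, inferInstance, fun _ => c, fun _ => e, fun _ => hc, fun _ => h,
    fun w _ => (Fintype.sum_unique (fun _ : Unit => c * ∏ x, w x ^ e x)).symm⟩

/-- Nonnegative constants. [this work] -/
theorem bposS_const {d : ℕ} {c : ℝ} (hc : 0 ≤ c) : BPosS (α := α) d (fun _ => c) :=
  (bposS_monomial hc (fun _ => 0) (by simp)).congr fun w _ => by simp

/-- The zero function. [this work] -/
theorem bposS_zero {d : ℕ} : BPosS (α := α) d (fun _ => 0) :=
  ⟨Fin 0, inferInstance, fun _ => 0, fun _ _ => 0, fun _ => le_rfl, fun _ => by simp, fun w _ => by simp⟩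

/-- A coordinate `w ↦ w_y` is `BPosS 1`. [this work] -/
theorem bposS_coord (y : α) : BPosS 1 (fun w : α → ℝ => w y) := by
  refine (bposS_monomial zero_le_one (fun x => if x = y then 1 else 0) (by simp)).congr fun w _ => ?_
  rw [one_mul, Fintype.prod_eq_single y (fun x hx => by rw [if_neg hx, pow_zero])]
  rw [if_pos rfl, pow_one]

/-- Sums. [this work] -/
theorem BPosS.add {d : ℕ} {f g : (α → ℝ) → ℝ} (hf : BPosS d f) (hg : BPosS d g) : BPosS d (fun w => f w + g w) := by
  obtain ⟨ι, hι, a, e, ha, he, hf⟩ := hf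
  obtain ⟨ι', hι', a', e', ha', he', hg⟩ := hg
  refine ⟨ι ⊕ ι', inferInstance, Sum.elim a a', Sum.elim e e', ?_, ?_, fun w hw => ?_⟩
  · rintro (i | i)
    · exact ha i
    · exact ha' i
  · rintro (i | i)
    · exact he i
    · exact he' i
  · show f w + g w = _
    rw [Fintype.sum_sum_type, hf w hw, hg w hw]
    simp only [Sum.elim_inl, Sum.elim_inr]

/-- Products (degrees add). [this work] -/
theorem BPosS.mul {d d' : ℕ} {f g : (α → ℝ) → ℝ} (hf : BPosS d f) (hg : BPosS d' g) :
    BPosS (d + d') (fun w => f w * g w) := by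
  obtain ⟨ι, hι, a, e, ha, he, hf⟩ := hf
  obtain ⟨ι', hι', a', e', ha', he', hg⟩ := hg
  refine ⟨ι × ι', inferInstance, fun i => a i.1 * a' i.2, fun i x => e i.1 x + e' i.2 x,
    fun i => mul_nonneg (ha _) (ha' _), fun i => ?_, fun w hw => ?_⟩
  · have h1 := he i.1
    have h2 := he' i.2
    show ∑ x, (e i.1 x + e' i.2 x) ≤ d + d'
    rw [sum_add_distrib]
    omega
  · show f w * g w = _
    rw [hf w hw, hg w hw, Finset.sum_mul_sum, Fintype.sum_prod_type]
    refine Finset.sum_congr rfl fun i _ => Finset.sum_congr rfl fun j _ => ?_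
    show a i * (∏ x, w x ^ e i x) * (a' j * ∏ x, w x ^ e' j x) = a i * a' j * ∏ x, w x ^ (e i x + e' j x)
    rw [prod_congr rfl (fun x _ => pow_add (w x) (e i x) (e' j x)), prod_mul_distrib]
    ring

/-- Nonnegative scalar multiples. [this work] -/
theorem BPosS.smul {d : ℕ} {f : (α → ℝ) → ℝ} (hf : BPosS d f) {c : ℝ} (hc : 0 ≤ c) : BPosS d (fun w => c * f w) :=
  ((bposS_const (α := α) (d := 0) hc).mul hf).mono (Nat.zero_add d).le

/-- Finite sums. [this work] -/
theorem BPosS.sum {d : ℕ} {κ : Type*} (s : Finset κ) (f : κ → (α → ℝ) → ℝ) (h : ∀ i ∈ s, BPosS d (f i)) :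
    BPosS d (fun w => ∑ i ∈ s, f i w) := by
  induction s using Finset.induction_on with
  | empty => exact bposS_zero.congr fun w _ => by simp
  | insert a s ha ih =>
    exact ((h a (mem_insert_self a s)).add (ih fun i hi => h i (mem_insert_of_mem hi))).congr
      fun w _ => (sum_insert ha (f := fun i => f i w)).symm

/-- Finite products of degree-`1` factors. [this work] -/
theorem BPosS.prod {κ : Type*} (s : Finset κ) (f : κ → (α → ℝ) → ℝ) (h : ∀ i ∈ s, BPosS 1 (f i)) :
    BPosS s.card (fun w => ∏ i ∈ s, f i w) := by
  induction s using Finset.induction_on with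
  | empty => exact (bposS_const zero_le_one).congr fun w _ => by simp
  | insert a s ha ih =>
    have hm := (h a (mem_insert_self a s)).mul (ih fun i hi => h i (mem_insert_of_mem hi))
    rw [card_insert_of_notMem ha]
    exact (hm.mono (by omega)).congr fun w _ => (prod_insert ha (f := fun i => f i w)).symm

/-- A linear form with `0/1` coefficients, `Σ_{x ∈ s} w_x`, is `BPosS 1`. [this work] -/
theorem bposS_sum_coord (s : Finset α) : BPosS 1 (fun w : α → ℝ => ∑ x ∈ s, w x) :=
  BPosS.sum s (fun x w => w x) fun x _ => bposS_coord x

/-- Nonnegativity on the standard simplex. [this work] -/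
theorem BPosS.nonneg {d : ℕ} {f : (α → ℝ) → ℝ} (h : BPosS d f) {w : α → ℝ} (hw0 : ∀ x, 0 ≤ w x) (hw1 : ∑ x, w x = 1) :
    0 ≤ f w := by
  obtain ⟨ι, hι, a, e, ha, he, hf⟩ := h
  rw [hf w hw1]
  exact Finset.sum_nonneg fun i _ => mul_nonneg (ha i) (prod_nonneg fun x _ => pow_nonneg (hw0 x) _)

/-! ### Multi-family mixtures -/

variable {n : ℕ}

/-- The mixture `Σ_x w_x 1_{𝒰_x}` of a finite family of families. [this work] -/
def mixS (𝒰 : α → Finset (Finset (Fin n))) (w : α → ℝ) : Finset (Fin n) → ℝ :=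
  fun S => ∑ x, w x * (if S ∈ 𝒰 x then 1 else 0)

/-- The restriction of a mixture along an embedding is the mixture of the pulled-back families. [this work] -/
theorem mixS_map {m : ℕ} (e : Fin m ↪ Fin n) (𝒰 : α → Finset (Finset (Fin n))) (w : α → ℝ) :
    (fun S : Finset (Fin m) => mixS 𝒰 w (S.map e)) = mixS (fun x => comap e (𝒰 x)) w := by
  funext S
  unfold mixS
  refine sum_congr rfl fun x _ => ?_
  by_cases h : S.map e ∈ 𝒰 x
  · rw [if_pos h, if_pos ((mem_comap e (𝒰 x) S).2 h)]
  · rw [if_neg h, if_neg (fun h' => h ((mem_comap e (𝒰 x) S).1 h'))]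

/-- Relabelling the ground set by a permutation: pulled-back families, same mixture functional. [this work] -/
theorem phiSet_mixS_comap_perm (σ : Perm (Fin (n + 1))) (𝒰 : α → Finset (Finset (Fin (n + 1)))) (w : α → ℝ) :
    phiSet (n + 1) (mixS (fun x => comap σ.toEmbedding (𝒰 x)) w) = phiSet (n + 1) (mixS 𝒰 w) := by
  rw [← mixS_map σ.toEmbedding 𝒰 w]
  exact PhiCert.phiSet_actV σ (mixS 𝒰 w)

omit [Fintype α] in
/-- Pull-back commutes with finite unions of families. [this work] -/
theorem comap_biUnion {m : ℕ} (e : Fin m ↪ Fin n) (𝒰 : α → Finset (Finset (Fin n))) (Y : Finset α) :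
    comap e (Y.biUnion 𝒰) = Y.biUnion (fun x => comap e (𝒰 x)) := by
  ext S
  simp only [mem_comap, mem_biUnion]

/-- On the simplex, the defect of a mixture at `S` is the linear form `Σ_x w_x [S ∉ 𝒰_x]`. [this work] -/
theorem one_sub_mixS (𝒰 : α → Finset (Finset (Fin n))) {w : α → ℝ} (hw : ∑ x, w x = 1) (S : Finset (Fin n)) :
    1 - mixS 𝒰 w S = ∑ x, w x * (1 - (if S ∈ 𝒰 x then (1 : ℝ) else 0)) := by
  unfold mixS
  calc 1 - ∑ x, w x * (if S ∈ 𝒰 x then (1 : ℝ) else 0)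
      = ∑ x, w x - ∑ x, w x * (if S ∈ 𝒰 x then (1 : ℝ) else 0) := by rw [hw]
    _ = ∑ x, w x * (1 - (if S ∈ 𝒰 x then (1 : ℝ) else 0)) := by
        rw [← sum_sub_distrib]; exact sum_congr rfl fun x _ => by ring

/-- Every defect factor `1 − β_S` of a mixture is `BPosS 1`. [this work] -/
theorem bposS_one_sub_mixS (𝒰 : α → Finset (Finset (Fin n))) (S : Finset (Fin n)) :
    BPosS 1 (fun w => 1 - mixS 𝒰 w S) := by
  refine (bposS_sum_coord (univ.filter fun x => S ∉ 𝒰 x)).congr fun w hw => ?_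
  rw [one_sub_mixS 𝒰 hw S, sum_filter]
  refine sum_congr rfl fun x _ => ?_
  by_cases h : S ∈ 𝒰 x
  · rw [if_pos h, if_neg (not_not.2 h)]; ring
  · rw [if_neg h, if_pos h]; ring

/-- `W(β) = Σ_σ ∏_{c ∈ cyc σ} (1 − β_c)` is `BPosS k` along any mixture on `Fin (k+1)`. [this work] -/
theorem bposS_W {k : ℕ} (𝒰 : α → Finset (Finset (Fin (k + 1)))) :
    BPosS k (fun w => ∑ σ : Perm (Fin k), ∏ B ∈ orbits σ, (1 - mixS 𝒰 w (B.map Fin.castSuccEmb))) := by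
  refine BPosS.sum univ (fun σ w => ∏ B ∈ orbits σ, (1 - mixS 𝒰 w (B.map Fin.castSuccEmb))) fun σ _ => ?_
  exact (BPosS.prod (orbits σ) (fun B w => 1 - mixS 𝒰 w (B.map Fin.castSuccEmb))
    fun B _ => bposS_one_sub_mixS 𝒰 _).mono (card_orbits_le σ)

end BernsteinSimplex

end Summit.CriticalPhenomena.PercolationContinuityZ3.Theorems
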